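import Literature.AlgebraicGeometry.Motives.HodgeStructureLefschetzGroupRestrictionToRepresentativesPoints
import Literature.AlgebraicGeometry.Motives.HodgeStructureCentralizerDiagonalActionPoints
import HarnessLib

/-!
# «`S(Aᵢ^{rᵢ}) ≅ S(Aᵢ)`» AND THE CANONICAL BLOCK ON `K`-POINTS, WITH THEIR FORMULAS: for every field `K ⊇ ℚ`, the diagonal action
# `S(H₀, ψ₀)(K) ⥲ S(⊕ᵢ Tᵢ ≅ H₀^{⊕ι}, ψ')(K)`, `(F g) ((Rᵢ)_K x) = (Rᵢ)_K (g x)`, and restriction `S(S, ψ|_S)(K) ⥲ S(U, ψ|_U)(K)`,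
# `(ι_U)_K ((F g) x) = (ι_S)_K (g (j_K x))` — «an immediate consequence of Proposition 1.1» read through «`S'(A) ≅ S(A)_{/k'}`»
# (Milne 1999 §1 p. 643 L12–L13, p. 644 L16–L28, Prop. 1.5, Remark 1.6)

[topic AlgebraicGeometry/Motives]

Layer `Literature/AlgebraicGeometry/Motives`, lane `lit-hodgefound` (Track 2 foundations library; prover seat
`lit-hodgefound-p02`, generation 53, self-proposed row g53-#9). THEOREMS ONLY: no definition, no named fact (net debt `0`),
no instance, no notation.  The `K`-points companion of g53-#4 (`Motives/HodgeStructureLefschetzGroupDiagonalAction`: the same two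
group isomorphisms on `ℚ`-points) and the FORMULA version of g52-#9's bare `Nonempty` statements
`Polarization.nonempty_lefschetzGroupBaseChange_mulEquiv_of_isInternal_of_forall_bijective` ∕
`Polarization.nonempty_lefschetzGroupBaseChange_restrict_mulEquiv_of_minimal_stable` (`Motives/HodgeStructureLefschetzGroupInternalBlocksPoints`).
Deduced, as Milne deduces Prop. 1.5 from Prop. 1.1, from the `K`-algebra-with-involution isomorphisms of g53-#8
(`Motives/HodgeStructureCentralizerDiagonalActionPoints`: `C(H₀)(K) ≃ₐ C(H')(K)` diagonal, `C(S)(K) ≃ₐ C(U)(K)` restriction, with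
formulas and `†_K`) through g53-#7's functoriality of `S(·)(K) = {γ ∈ C(·)(K) | γ†γ = 1}` in `(C(·)(K), †_K)`
(`Polarization.exists_lefschetzGroupBaseChange_mulEquiv_coe_eq_of_algEquiv_centralizerAdjoint`,
`Motives/HodgeStructureLefschetzGroupRestrictionToRepresentativesPoints`) — all BY NAME, nothing restated.

## The source, verbatim

J. S. Milne, *Lefschetz classes on abelian varieties*, Duke Math. J. 96 (1999) 639–675 [Milne1999LefschetzClasses] (held
`paper:doi-10-1215-s0012-7094-99-09620-5`), §1 p. 643 L12–L13: "the diagonal action of `C(A)` on `rV(A)` identifies `C(A)` with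
`C(A^r)` (as `k`-algebras with involution)"; p. 644 L16–L28: "`S(A)(R) = {γ ∈ C(A) ⊗_k R | γ†γ = 1}`. […] Clearly `S(A)` depends
only on the isogeny class of `A` (up to a unique isomorphism). […] **Proposition 1.5.** […] Any such isogeny induces an isomorphism
`S(A₁) × ⋯ × S(A_s) → S(A)`, which is independent of the choice of the isogeny. *Proof.* This is an immediate consequence of
Proposition 1.1." (whose proof decomposes `S(A) ≅ ∏ᵢ S(Aᵢ^{rᵢ})` and identifies `S(Aᵢ^{rᵢ}) ≅ S(Aᵢ)` diagonally); L29–L34: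
"**Remark 1.6.** […] there are canonical isomorphisms `C'(A) ≅ C(A) ⊗_k k'`, `S'(A) ≅ S(A)_{/k'}`."  Also H. Lange
[Lange2023AbelianVarietiesComplex] §7.2.4 Exercise (4), D. Huybrechts [Huybrechts2016K3] §3.3.5 eq. (3.3).

## Dictionary and what is proved (namespace `Literature.AlgebraicGeometry.Motives.HodgeStructure`)

`S(H, Q)(K) = Q.lefschetzGroupBaseChange K ≤ GL(K ⊗_ℚ V)`, `C(H)(K) = Subalgebra.centralizer K {a_K : a ∈ E_φ(H)}`,
`Rᵢ = ιᵢ ∘ rᵢ = (T i).toSubmodule.subtype ∘ₗ (r i).toLinearMap`, `(·)_K = LinearMap.baseChange K`, `j = Submodule.inclusion hUS : U ↪ S`.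

* §1 (internal `V' = ⊕ᵢ Tᵢ`, Hodge isomorphisms `rᵢ : H₀ ⥲ Tᵢ`) `Polarization.lefschetzGroupBaseChange_map_eq_of_forall_apply_baseChange_eq`
  (UNIQUENESS of a diagonal map `S(H₀)(K) → S(H')(K)`), **`Polarization.exists_lefschetzGroupBaseChange_mulEquiv_apply_baseChange_eq
  [Nonempty ι] (ψ₀ ψ') : ∃ F : S(H₀, ψ₀)(K) ≃* S(H', ψ')(K), ∀ g i x, (F g) ((Rᵢ)_K x) = (Rᵢ)_K (g x)`** (THE DIAGONAL ACTION ON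
  `K`-POINTS, any polarizations — «`S(Aᵢ^{rᵢ}) ≅ S(Aᵢ)`»).
* §2 (polarized `H`, `S` minimal non-zero `E_φ`-stable, `U ≤ S` irreducible)
  `Polarization.lefschetzGroupBaseChange_restrict_map_eq_of_forall_subtype_baseChange_apply_eq` (uniqueness of a map over the
  restriction), **`Polarization.exists_lefschetzGroupBaseChange_restrict_mulEquiv_subtype_baseChange_apply_eq_of_minimal_stable :
  ∃ F : S(S, ψ|_S)(K) ≃* S(U, ψ|_U)(K), ∀ g x, (ι_U)_K ((F g) x) = (ι_S)_K (g (j_K x))`** (RESTRICTION IS THE ISOMORPHISM, on `K`-points),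
  `Polarization.existsUnique_mem_lefschetzGroupBaseChange_restrict_forall_subtype_baseChange_apply_eq_of_minimal_stable` (every
  `δ ∈ S(U)(K)` is the restriction of a unique `g ∈ S(S)(K)`).
-/

noncomputable section

open scoped TensorProduct

namespace Literature.AlgebraicGeometry.Motives

namespace HodgeStructure

universe u uK

variable (K : Type uK) [Field K] [Algebra ℚ K] {n : ℤ}

/-! ## §1 The diagonal action `S(H₀)(K) ⥲ S(⊕ᵢ Tᵢ)(K)`, with its formula -/

section Diagonal

variable {V' : Type u} [AddCommGroup V'] [Module ℚ V'] [Module.Finite ℚ V'] {H' : HodgeStructure V' n}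
  {W₀ : Type u} [AddCommGroup W₀] [Module ℚ W₀] [Module.Finite ℚ W₀] {H₀ : HodgeStructure W₀ n}
  {ι : Type} [Fintype ι] [DecidableEq ι] (T : ι → SubHodgeStructure H')
  (hT : DirectSum.IsInternal fun i => (T i).toSubmodule)
  (r : ∀ i, Hom H₀ (T i).toHodgeStructure) (hr : ∀ i, Function.Bijective (r i).toLinearMap)
  (ψ₀ : Polarization H₀) (ψ' : Polarization H')

include hT hr

omit [Module.Finite ℚ V'] [Module.Finite ℚ W₀] [Fintype ι] in
/-- **UNIQUENESS of the diagonal action on `S(K)`**: two maps `F, F' : S(H₀)(K) → S(H')(K)` which both act diagonally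
(`(F g) ((Rᵢ)_K x) = (Rᵢ)_K (g x)` for all `i`) COINCIDE — the `(Rᵢ)_K (K ⊗ W₀)` span `K ⊗ V'` (g53-#8).
[cite: Milne1999LefschetzClasses, §1 p. 644 L20–L21 («up to a unique isomorphism») and Remark 1.6] -/
theorem Polarization.lefschetzGroupBaseChange_map_eq_of_forall_apply_baseChange_eq
    (F F' : ψ₀.lefschetzGroupBaseChange K → ψ'.lefschetzGroupBaseChange K)
    (hF : ∀ (g : ψ₀.lefschetzGroupBaseChange K) (i : ι) (x : K ⊗[ℚ] W₀),
      ((F g : ψ'.lefschetzGroupBaseChange K) : (K ⊗[ℚ] V') ≃ₗ[K] (K ⊗[ℚ] V')) (((T i).toSubmodule.subtype ∘ₗ (r i).toLinearMap).baseChange K x) =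
        ((T i).toSubmodule.subtype ∘ₗ (r i).toLinearMap).baseChange K ((g : (K ⊗[ℚ] W₀) ≃ₗ[K] (K ⊗[ℚ] W₀)) x))
    (hF' : ∀ (g : ψ₀.lefschetzGroupBaseChange K) (i : ι) (x : K ⊗[ℚ] W₀),
      ((F' g : ψ'.lefschetzGroupBaseChange K) : (K ⊗[ℚ] V') ≃ₗ[K] (K ⊗[ℚ] V')) (((T i).toSubmodule.subtype ∘ₗ (r i).toLinearMap).baseChange K x) =
        ((T i).toSubmodule.subtype ∘ₗ (r i).toLinearMap).baseChange K ((g : (K ⊗[ℚ] W₀) ≃ₗ[K] (K ⊗[ℚ] W₀)) x)) :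
    F = F' :=
  funext fun g => Subtype.ext (LinearEquiv.toLinearMap_injective
    (linearMap_eq_of_forall_apply_baseChange_hom_eq K T hT r hr _ _ fun i x => by
      rw [LinearEquiv.coe_coe, LinearEquiv.coe_coe, hF, hF']))

/-- **THE DIAGONAL ACTION ON `K`-POINTS, WITH ITS FORMULA** («`S(Aᵢ^{rᵢ}) ≅ S(Aᵢ)`» inside the proof of Prop. 1.5, read through
«`S'(A) ≅ S(A)_{/k'}`»): for Hodge isomorphisms `rᵢ : H₀ ⥲ Tᵢ` onto the blocks of an internal direct sum `V' = ⊕ᵢ Tᵢ` (`ι` non-empty),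
ANY polarizations `ψ₀` of `H₀` and `ψ'` of `H'`, and every field `K ⊇ ℚ`, there is an isomorphism of groups
`F : S(H₀, ψ₀)(K) ≃* S(H', ψ')(K)` acting DIAGONALLY: `(F g) ((Rᵢ)_K x) = (Rᵢ)_K (g x)` — induced (g53-#7 §1) by the diagonal
isomorphism of `K`-algebras with involution `C(H₀)(K) ≃ₐ[K] C(H')(K)` of g53-#8.
[cite: Milne1999LefschetzClasses, §1 p. 643 L12–L13, Prop. 1.5 with its proof and Remark 1.6 (p. 644)] [cite: Lange2023AbelianVarietiesComplex, §7.2.4 Exercise (4)] -/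
theorem Polarization.exists_lefschetzGroupBaseChange_mulEquiv_apply_baseChange_eq [Nonempty ι] :
    ∃ F : ψ₀.lefschetzGroupBaseChange K ≃* ψ'.lefschetzGroupBaseChange K,
      ∀ (g : ψ₀.lefschetzGroupBaseChange K) (i : ι) (x : K ⊗[ℚ] W₀),
        ((F g : ψ'.lefschetzGroupBaseChange K) : (K ⊗[ℚ] V') ≃ₗ[K] (K ⊗[ℚ] V'))
            (((T i).toSubmodule.subtype ∘ₗ (r i).toLinearMap).baseChange K x) =
          ((T i).toSubmodule.subtype ∘ₗ (r i).toLinearMap).baseChange K ((g : (K ⊗[ℚ] W₀) ≃ₗ[K] (K ⊗[ℚ] W₀)) x) := by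
  obtain ⟨E, hE, hadj⟩ := exists_centralizer_baseChange_algEquiv_apply_baseChange_eq K T hT r hr
  obtain ⟨F, hF⟩ := ψ₀.exists_lefschetzGroupBaseChange_mulEquiv_coe_eq_of_algEquiv_centralizerAdjoint K ψ' E (hadj ψ₀ ψ')
  refine ⟨F, fun g i x => ?_⟩
  have h := LinearMap.congr_fun (hF g) (((T i).toSubmodule.subtype ∘ₗ (r i).toLinearMap).baseChange K x)
  rw [LinearEquiv.coe_coe] at h
  rw [h, hE]
  rfl

end Diagonal

/-! ## §2 The canonical block: restriction `S(S)(K) ⥲ S(U)(K)`, with its formula -/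

section CanonicalBlock

variable {V : Type u} [AddCommGroup V] [Module ℚ V] [Module.Finite ℚ V] {H : HodgeStructure V n} (ψ : Polarization H)
  {S U : SubHodgeStructure H} (hUS : U.toSubmodule ≤ S.toSubmodule)

include hUS

omit [Module.Finite ℚ V] in
/-- **Uniqueness of a map over the restriction on `S(K)`**: two maps `F, F' : S(S)(K) → S(U)(K)` with
`(ι_U)_K ((F g) x) = (ι_S)_K (g (j_K x))` COINCIDE — `(ι_U)_K` is injective, `K` being flat over `ℚ`.
[cite: Milne1999LefschetzClasses, §1 p. 644 L20–L21 and Remark 1.6] [cite: BourbakiAlgebraI1989, Ch. II §5 no. 3 Prop. 7] -/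
theorem Polarization.lefschetzGroupBaseChange_restrict_map_eq_of_forall_subtype_baseChange_apply_eq
    (F F' : (ψ.restrict S).lefschetzGroupBaseChange K → (ψ.restrict U).lefschetzGroupBaseChange K)
    (hF : ∀ (g : (ψ.restrict S).lefschetzGroupBaseChange K) (x : K ⊗[ℚ] U.toSubmodule),
      U.toSubmodule.subtype.baseChange K
          (((F g : (ψ.restrict U).lefschetzGroupBaseChange K) : (K ⊗[ℚ] U.toSubmodule) ≃ₗ[K] (K ⊗[ℚ] U.toSubmodule)) x) =
        S.toSubmodule.subtype.baseChange K
          ((g : (K ⊗[ℚ] S.toSubmodule) ≃ₗ[K] (K ⊗[ℚ] S.toSubmodule)) ((Submodule.inclusion hUS).baseChange K x)))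
    (hF' : ∀ (g : (ψ.restrict S).lefschetzGroupBaseChange K) (x : K ⊗[ℚ] U.toSubmodule),
      U.toSubmodule.subtype.baseChange K
          (((F' g : (ψ.restrict U).lefschetzGroupBaseChange K) : (K ⊗[ℚ] U.toSubmodule) ≃ₗ[K] (K ⊗[ℚ] U.toSubmodule)) x) =
        S.toSubmodule.subtype.baseChange K
          ((g : (K ⊗[ℚ] S.toSubmodule) ≃ₗ[K] (K ⊗[ℚ] S.toSubmodule)) ((Submodule.inclusion hUS).baseChange K x))) :
    F = F' := by
  have hinj : Function.Injective (U.toSubmodule.subtype.baseChange K) := by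
    rw [LinearMap.baseChange_eq_ltensor]
    exact Module.Flat.lTensor_preserves_injective_linearMap _ U.toSubmodule.injective_subtype
  exact funext fun g => Subtype.ext (LinearEquiv.ext fun x => hinj (by rw [hF, hF']))

variable (hS : (∀ a ∈ H.endAlg, ∀ v ∈ S.toSubmodule, a v ∈ S.toSubmodule) ∧ S.toSubmodule ≠ ⊥ ∧
    ∀ S' : SubHodgeStructure H, (∀ a ∈ H.endAlg, ∀ v ∈ S'.toSubmodule, a v ∈ S'.toSubmodule) →
      S'.toSubmodule ≤ S.toSubmodule → S'.toSubmodule = ⊥ ∨ S'.toSubmodule = S.toSubmodule)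
  (hU : U.toHodgeStructure.IsIrreducible)

include hS hU

/-- **THE CANONICAL BLOCK ON `K`-POINTS: restriction to `K ⊗ U` is an isomorphism of groups
`F : S(S, ψ|_S)(K) ≃* S(U, ψ|_U)(K)`, `(ι_U)_K ((F g) x) = (ι_S)_K (g (j_K x))`**, for a minimal non-zero `E_φ`-stable sub-Hodge
structure `S` of a polarized `H` and an irreducible `U ≤ S` — induced (g53-#7 §1) by the restriction isomorphism of `K`-algebras with
involution `C(S)(K) ≃ₐ[K] C(U)(K)` of g53-#8.
[cite: Milne1999LefschetzClasses, §1 p. 643 L12–L13, Prop. 1.5 and Remark 1.6 (p. 644)] [cite: Lange2023AbelianVarietiesComplex, §7.2.4 Exercise (4)] -/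
theorem Polarization.exists_lefschetzGroupBaseChange_restrict_mulEquiv_subtype_baseChange_apply_eq_of_minimal_stable :
    ∃ F : (ψ.restrict S).lefschetzGroupBaseChange K ≃* (ψ.restrict U).lefschetzGroupBaseChange K,
      ∀ (g : (ψ.restrict S).lefschetzGroupBaseChange K) (x : K ⊗[ℚ] U.toSubmodule),
        U.toSubmodule.subtype.baseChange K
            (((F g : (ψ.restrict U).lefschetzGroupBaseChange K) : (K ⊗[ℚ] U.toSubmodule) ≃ₗ[K] (K ⊗[ℚ] U.toSubmodule)) x) =
          S.toSubmodule.subtype.baseChange K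
            ((g : (K ⊗[ℚ] S.toSubmodule) ≃ₗ[K] (K ⊗[ℚ] S.toSubmodule)) ((Submodule.inclusion hUS).baseChange K x)) := by
  obtain ⟨E, hE, hadj⟩ :=
    ψ.exists_centralizer_baseChange_algEquiv_subtype_baseChange_apply_eq_adjoint_of_minimal_stable K hUS hS hU
  obtain ⟨F, hF⟩ :=
    (ψ.restrict S).exists_lefschetzGroupBaseChange_mulEquiv_coe_eq_of_algEquiv_centralizerAdjoint K (ψ.restrict U) E hadj
  refine ⟨F, fun g x => ?_⟩
  have h := LinearMap.congr_fun (hF g) x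
  rw [LinearEquiv.coe_coe] at h
  rw [h, hE]
  rfl

/-- **Every `δ ∈ S(U, ψ|_U)(K)` is the restriction of a UNIQUE `g ∈ S(S, ψ|_S)(K)`** (bijectivity of restriction on the canonical
block, on `K`-points, spelled out on `GL(K ⊗ S)`). [cite: Milne1999LefschetzClasses, §1 Prop. 1.5 and Remark 1.6 (p. 644)] -/
theorem Polarization.existsUnique_mem_lefschetzGroupBaseChange_restrict_forall_subtype_baseChange_apply_eq_of_minimal_stable
    (δ : (ψ.restrict U).lefschetzGroupBaseChange K) :
    ∃! g : (K ⊗[ℚ] S.toSubmodule) ≃ₗ[K] (K ⊗[ℚ] S.toSubmodule), g ∈ (ψ.restrict S).lefschetzGroupBaseChange K ∧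
      ∀ x : K ⊗[ℚ] U.toSubmodule,
        U.toSubmodule.subtype.baseChange K ((δ : (K ⊗[ℚ] U.toSubmodule) ≃ₗ[K] (K ⊗[ℚ] U.toSubmodule)) x) =
          S.toSubmodule.subtype.baseChange K (g ((Submodule.inclusion hUS).baseChange K x)) := by
  obtain ⟨F, hF⟩ := ψ.exists_lefschetzGroupBaseChange_restrict_mulEquiv_subtype_baseChange_apply_eq_of_minimal_stable K hUS hS hU
  have hinj : Function.Injective (U.toSubmodule.subtype.baseChange K) := by
    rw [LinearMap.baseChange_eq_ltensor]
    exact Module.Flat.lTensor_preserves_injective_linearMap _ U.toSubmodule.injective_subtype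
  refine ⟨(F.symm δ : (ψ.restrict S).lefschetzGroupBaseChange K), ⟨(F.symm δ).2, fun x => ?_⟩, fun g' hg' => ?_⟩
  · rw [← hF (F.symm δ) x, MulEquiv.apply_symm_apply]
  · obtain ⟨hg'S, hg'⟩ := hg'
    have h : F ⟨g', hg'S⟩ = δ := Subtype.ext (LinearEquiv.ext fun x => hinj (by rw [hF, hg']))
    have h' : (⟨g', hg'S⟩ : (ψ.restrict S).lefschetzGroupBaseChange K) = F.symm δ := by
      rw [← h, MulEquiv.symm_apply_apply]
    exact congrArg Subtype.val h'

end CanonicalBlock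

end HodgeStructure

end Literature.AlgebraicGeometry.Motives
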